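import Summits.Ventures.QEC.Thresholds.ToricCodeMWPMThresholdsSymmK16
import Summits.Ventures.QEC.Thresholds.ToricCodeLatticePhenomConverses
import Literature.InformationTheory.QuantumCodes.CSSPhenomenologicalReindex
import HarnessLib

/-!
# The toric code, `X`-SECTOR under PHENOMENOLOGICAL noise IS a `Z`-sector problem (space-time duality):
# `p_c^{X,ph} > .0112` for every minimum-weight space-time decoder family of the plaquette record — UNCONDITIONAL, kernel

Venture QEC, `Summits/Ventures/QEC/Thresholds/` (LADDER-QEC rung Q5, PARTITION row 09 "phenomenological"; qec-type-09 gen 5,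
item 09.PHX). Until now the `X`-sector phenomenological row of the toric code (bit flips at rate `p` per round, noisy
PLAQUETTE-syndrome record at rate `q`, `T(L)` rounds, perfect closing round) carried only the Dumer–Kovalev–Pryadko cluster
constant `p₀(5) ≈ .0101` (`ToricCodeXSectorPhenomenological.lean`; its docstring: "the sharper `Z`-sector constants come from
the space-time self-avoiding-polygon route, whose `X`-sector twin needs the space-time duality — not done here"). This file
supplies that duality WITHOUT re-running the polygon argument: by qec-lit-2's `ToricCode.toricCode_swap_eq_reindex` the
exchanged toric code is the toric code RE-INDEXED along the lattice duality (`dualEdge`, `s ↦ -s`), and by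
`CSSPhenomenologicalReindex.lean` (qec-type-09 gen 5) the whole space-time decoding problem — record, cycles, harmless set,
minimum-weight class, two-rate failure probability — is invariant under re-indexing. Hence (`toric_xPhenomFailureProb_eq_dual`)
the `X`-sector two-rate failure probability of ANY space-time decoder `DX` of the plaquette record equals the `Z`-sector
failure probability `ToricCode.phenomFailureProb` of its space-time dual decoder, which is minimum-weight when `DX` is
(`toric_isMinWeight_stDual`); so every `Z`-sector phenomenological theorem of the tree that holds for all minimum-weight
space-time decoder families holds verbatim for the `X` sector (`toric_x_phenom_isThresholdLowerBound_of_z`). Instances at the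
current kernel certificate `μ(ℤ³) ≤ 4.7476` (qec-type-03, `ToricCodePhenomenologicalKernelZ3SymmK12.lean`):

| theorem | statement |
|---|---|
| `toric_x_phenom_isThresholdLowerBound_kernelZ3SymmK12`, `toric_x_phenom_accuracyThreshold_gt_0112`, `…_stMinWeight` | `X` sector, `q = p`, poly `T`, every min-weight space-time decoder family of the plaquette record: `≥ p₀(4.7476)`, **`p_c > .0112`** (was `.0101`) |
| `toric_x_phenom_accuracyThreshold_mem_0112` | certified interval **`.0112 < p_c^{X,ph} ≤ 1/4`** (ceiling: qec-lit-2, every space-time decoder family) |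
| `toric_x_phenom_aniso_belowThreshold_kernelZ3SymmK12`, `toric_x_phenom_aniso_belowThreshold_0112` | two rates: `max(p,q) < p₀(4.7476)`, resp. `p, q ≤ .0112` ⇒ `Prob_fail^X(p,q) → 0` |
| `toric_x_phenom_isThresholdBoxLowerBound_kernelZ3SymmK12`, `toric_x_phenom_isThresholdBoxLowerBound_0112` | boxes `p₀(4.7476)` / **`.0112`** for `xPhenomFailureFamily₂` |
| `toric_x_phenom_decaysExponentially_0112` | exponential decay in `L` at every `0 ≤ p ≤ .0112` |
| `toric_bothSectors_phenom_belowThreshold_0112` | both records decoded by min-weight space-time decoders: BOTH sector failure probabilities `→ 0` for `p, q ≤ .0112` |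

All UNCONDITIONAL, tier CERTIFIED (kernel), axioms standard, 0 named facts, no `native_decide`; certified LOWER bounds on the
threshold (region); the printed `p, q < .0114` remains a CLAIM. Theorem-only file.

## References

* [DennisEtAl2002] E. Dennis, A. Kitaev, A. Landahl, J. Preskill, *Topological quantum memory*, J. Math. Phys. 43 (2002)
  4452–4505, arXiv:quant-ph/0110143, §4.1 ("we may treat X errors and Z errors separately"), §4.2 (both check types are
  measured repeatedly), §5.1 p. 19, §5.3 eqs. (threshold_iso), (threshold_iso_num), (fail_iso).
* [PonitzTittmann2000] A. Pönitz, P. Tittmann, Electron. J. Combin. 7 (2000) R21, Table 2 (`d = 3, k = 12`: `4.7476`).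
-/

noncomputable section

namespace Summit.Ventures.QEC.Thresholds

open Filter Topology Finset Matrix
open Literature.InformationTheory.QuantumCodes
open Literature.InformationTheory.QuantumCodes.ToricCode
open Literature.Probability.RandomPlanarGeometry

/-! ### The space-time duality -/

/-- The plaquette matrix is the star matrix re-indexed along the lattice duality (`H^Z_{w,ℓ} = H^X_{-w, ℓ*}`), in
`Matrix.reindex` form. [cite: DennisEtAl2002, §3.1 (lattice and dual lattice)] -/
theorem toric_HZ_eq_reindex_HX (L : ℕ) [NeZero L] :
    (toricCode L).HZ =
      Matrix.reindex (Equiv.neg (Vertex L)).symm (dualEdge L).symm (toricCode L).HX := by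
  change (toricCode L).swap.HX = _
  rw [toricCode_swap_eq_reindex, CSSCode.reindex_HX]

/-- The `X`-stabilizers (stars) are the plaquette boundaries transported along the duality:
`x ∈ rs H^X ↔ x ∘ (dualEdge)⁻¹ ∈ boundaries`. [cite: DennisEtAl2002, §3.1 (stars on the lattice are plaquettes on the dual lattice)] -/
theorem toric_mem_rowSpX_iff_comp_mem_boundaries (L : ℕ) [NeZero L] (x : Chain L) :
    x ∈ ((toricCode L).rowSpX : Set (Chain L)) ↔ x ∘ ⇑(dualEdge L).symm ∈ boundaries L := by
  change x ∈ (toricCode L).swap.rowSpZ ↔ x ∘ ⇑(dualEdge L).symm ∈ ((toricCode L).rowSpZ : Set (Chain L))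
  rw [toricCode_swap_eq_reindex]
  exact CSSCode.mem_rowSpZ_reindex_iff _ _ _ _ x

/-- **The `X`-sector two-rate failure probability is a `Z`-sector one**: for EVERY space-time decoder `DX` of the
plaquette record of the `L × L` toric code (`T` rounds) and every `(p, q)`, its failure probability equals
`ToricCode.phenomFailureProb L T DX° p q` for the space-time dual decoder `DX°` (read the star record at the antipodal
sites, decode, dualise the history). [cite: DennisEtAl2002, §4.1–4.2 (X errors: the same problem on the dual lattice)] -/
theorem toric_xPhenomFailureProb_eq_dual (L T : ℕ) [NeZero L]
    (DX : CSSPhenom.STDecoder (Vertex L) (Edge L) T) (p q : ℝ) :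
    CSSPhenom.phenomFailureProb (toricCode L).HZ T ((toricCode L).rowSpX : Set (Chain L)) DX p q =
      ToricCode.phenomFailureProb L T
        (fun s : STSyndrome L T =>
          DX (s ∘ ⇑((Equiv.neg (Vertex L)).symm.prodCongr (Equiv.refl (Fin (T + 1)))).symm) ∘
            ⇑(Equiv.sumCongr ((dualEdge L).symm.prodCongr (Equiv.refl (Fin T)))
              ((Equiv.neg (Vertex L)).symm.prodCongr (Equiv.refl (Fin T)))))
        p q := by
  rw [toric_HZ_eq_reindex_HX]
  exact CSSPhenom.phenomFailureProb_pullback (toricCode L).HX _ _ T (SX := boundaries L)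
    (toric_mem_rowSpX_iff_comp_mem_boundaries L) DX p q

/-- **The space-time dual of a minimum-weight decoder is minimum-weight** (record `stSyn L T`, cycles `stCycles L T`,
number of faulty links). [cite: DennisEtAl2002, §5.1 eq. (E_min) (on the dual lattice alike)] -/
theorem toric_isMinWeight_stDual (L T : ℕ) [NeZero L] {DX : CSSPhenom.STDecoder (Vertex L) (Edge L) T}
    (hDX : DX.IsMinWeight (CSSPhenom.stSyn (toricCode L).HZ T) (CSSPhenom.stCycles (toricCode L).HZ T) hammingNorm) :
    Decoder.IsMinWeight
      (fun s : STSyndrome L T =>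
        DX (s ∘ ⇑((Equiv.neg (Vertex L)).symm.prodCongr (Equiv.refl (Fin (T + 1)))).symm) ∘
          ⇑(Equiv.sumCongr ((dualEdge L).symm.prodCongr (Equiv.refl (Fin T)))
            ((Equiv.neg (Vertex L)).symm.prodCongr (Equiv.refl (Fin T)))))
      (stSyn L T) (stCycles L T) hammingNorm := by
  rw [toric_HZ_eq_reindex_HX] at hDX
  exact CSSPhenom.isMinWeight_pullback (toricCode L).HX _ _ hDX

/-- **Family form**: the `X`-sector phenomenological family of the toric codes decoded by `DX` IS the `Z`-sector family
`phenomFailureFamily T DX°` of the space-time dual decoders. [cite: DennisEtAl2002, §4.1 and §5.3 (p = q)] -/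
theorem xPhenomFailureFamily_toricCode (T : ℕ → ℕ)
    (DX : ∀ L, CSSPhenom.STDecoder (Vertex (L + 1)) (Edge (L + 1)) (T L)) :
    xPhenomFailureFamily (fun L => toricCode (L + 1)) T DX =
      phenomFailureFamily T fun L =>
        fun s : STSyndrome (L + 1) (T L) =>
          DX L (s ∘ ⇑((Equiv.neg (Vertex (L + 1))).symm.prodCongr (Equiv.refl (Fin (T L + 1)))).symm) ∘
            ⇑(Equiv.sumCongr ((dualEdge (L + 1)).symm.prodCongr (Equiv.refl (Fin (T L))))
              ((Equiv.neg (Vertex (L + 1))).symm.prodCongr (Equiv.refl (Fin (T L))))) := by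
  funext L p
  exact toric_xPhenomFailureProb_eq_dual (L + 1) (T L) (DX L) p p

/-- **Two-rate family form**: `xPhenomFailureFamily₂ (toricCode ·) T DX = phenomFailureFamily₂ T DX°`.
[cite: DennisEtAl2002, §4.2 (rates p, q) and §4.1] -/
theorem xPhenomFailureFamily₂_toricCode (T : ℕ → ℕ)
    (DX : ∀ L, CSSPhenom.STDecoder (Vertex (L + 1)) (Edge (L + 1)) (T L)) :
    xPhenomFailureFamily₂ (fun L => toricCode (L + 1)) T DX =
      phenomFailureFamily₂ T fun L =>
        fun s : STSyndrome (L + 1) (T L) =>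
          DX L (s ∘ ⇑((Equiv.neg (Vertex (L + 1))).symm.prodCongr (Equiv.refl (Fin (T L + 1)))).symm) ∘
            ⇑(Equiv.sumCongr ((dualEdge (L + 1)).symm.prodCongr (Equiv.refl (Fin (T L))))
              ((Equiv.neg (Vertex (L + 1))).symm.prodCongr (Equiv.refl (Fin (T L))))) := by
  funext L p q
  exact toric_xPhenomFailureProb_eq_dual (L + 1) (T L) (DX L) p q

/-! ### Transfer principle and instances -/

/-- **Transfer principle**: a `Z`-sector phenomenological threshold bound valid for EVERY minimum-weight space-time
decoder family (schedule `T`) is an `X`-sector bound for every minimum-weight space-time decoder family of the plaquette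
record. [cite: DennisEtAl2002, §4.1 ("we may treat X errors and Z errors separately" — identically, by duality)] -/
theorem toric_x_phenom_isThresholdLowerBound_of_z {T : ℕ → ℕ} {p₀ : ℝ}
    (hZ : ∀ D : (L : ℕ) → STDecoder (L + 1) (T L),
      (∀ L, (D L).IsMinWeight (stSyn (L + 1) (T L)) (stCycles (L + 1) (T L)) hammingNorm) →
        IsThresholdLowerBound (phenomFailureFamily T D) p₀)
    (DX : ∀ L, CSSPhenom.STDecoder (Vertex (L + 1)) (Edge (L + 1)) (T L))
    (hDX : ∀ L, (DX L).IsMinWeight (CSSPhenom.stSyn (toricCode (L + 1)).HZ (T L))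
      (CSSPhenom.stCycles (toricCode (L + 1)).HZ (T L)) hammingNorm) :
    IsThresholdLowerBound (xPhenomFailureFamily (fun L => toricCode (L + 1)) T DX) p₀ := by
  rw [xPhenomFailureFamily_toricCode]
  exact hZ _ fun L => toric_isMinWeight_stDual (L + 1) (T L) (hDX L)

/-- **`X`-sector phenomenological toric threshold `≥ p₀(4.7476)`** for every polynomially bounded schedule and every
minimum-weight space-time decoder family of the plaquette record — UNCONDITIONAL, tier CERTIFIED (kernel), from the
symmetry-reduced cubic memory-12 certificate `μ(ℤ³) ≤ 4.7476`. [cite: DennisEtAl2002, §5.3 eqs. (saw_3), (threshold_iso_num)] -/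
theorem toric_x_phenom_isThresholdLowerBound_kernelZ3SymmK12 {T : ℕ → ℕ} (hT : IsPolyBounded T)
    (DX : ∀ L, CSSPhenom.STDecoder (Vertex (L + 1)) (Edge (L + 1)) (T L))
    (hDX : ∀ L, (DX L).IsMinWeight (CSSPhenom.stSyn (toricCode (L + 1)).HZ (T L))
      (CSSPhenom.stCycles (toricCode (L + 1)).HZ (T L)) hammingNorm) :
    IsThresholdLowerBound (xPhenomFailureFamily (fun L => toricCode (L + 1)) T DX) (thresholdValue 4.7476) :=
  toric_x_phenom_isThresholdLowerBound_of_z (fun _ hD => phenomThreshold_kernelZ3SymmK12 hT hD) DX hDX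

/-- **`p_c^{X,ph} > .0112`** (decimal, kernel) for bit flips with a noisy plaquette record on the toric code, every
minimum-weight space-time decoder family, every polynomially bounded schedule (was `.0101`) — UNCONDITIONAL.
[cite: DennisEtAl2002, §5.3 eq. (threshold_iso_num)] -/
theorem toric_x_phenom_accuracyThreshold_gt_0112 {T : ℕ → ℕ} (hT : IsPolyBounded T)
    (DX : ∀ L, CSSPhenom.STDecoder (Vertex (L + 1)) (Edge (L + 1)) (T L))
    (hDX : ∀ L, (DX L).IsMinWeight (CSSPhenom.stSyn (toricCode (L + 1)).HZ (T L))
      (CSSPhenom.stCycles (toricCode (L + 1)).HZ (T L)) hammingNorm) :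
    (0.0112 : ℝ) < accuracyThreshold (xPhenomFailureFamily (fun L => toricCode (L + 1)) T DX) :=
  lt_of_lt_of_le thresholdValue_47476_bounds.1
    (le_accuracyThreshold (toric_x_phenom_isThresholdLowerBound_kernelZ3SymmK12 hT DX hDX)
      ((thresholdValue_le_half _).trans (by norm_num)))

/-- Canonical instance: `T(L) = L + 1` rounds, minimum-weight space-time decoding of the plaquette record —
`p_c^{X,ph} > .0112`. [cite: DennisEtAl2002, §5.1 eq. (E_min) (on the dual lattice)] -/
theorem toric_x_phenom_accuracyThreshold_stMinWeight_gt_0112 :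
    (0.0112 : ℝ) < accuracyThreshold
      (xPhenomFailureFamily (fun L => toricCode (L + 1)) (fun L => L + 1)
        fun L => Decoder.minWeight (CSSPhenom.stSyn (toricCode (L + 1)).HZ (L + 1)) hammingNorm) :=
  toric_x_phenom_accuracyThreshold_gt_0112 isPolyBounded_succ _ fun _ => CSSPhenom.isMinWeight_minWeight _ _

/-- **Certified interval `.0112 < p_c^{X,ph} ≤ 1/4`** (floor: every minimum-weight space-time decoder family of the
plaquette record, poly `T_L ≥ 1`; ceiling: qec-lit-2's genie bound, every space-time decoder family).
[cite: DennisEtAl2002, §5.3 eq. (threshold_iso_num) and §4.6; RichardsonUrbanke2008, Lemma 4.78] -/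
theorem toric_x_phenom_accuracyThreshold_mem_0112 {T : ℕ → ℕ} (hT : IsPolyBounded T) (hT1 : ∀ L, 0 < T L)
    (DX : ∀ L, CSSPhenom.STDecoder (Vertex (L + 1)) (Edge (L + 1)) (T L))
    (hDX : ∀ L, (DX L).IsMinWeight (CSSPhenom.stSyn (toricCode (L + 1)).HZ (T L))
      (CSSPhenom.stCycles (toricCode (L + 1)).HZ (T L)) hammingNorm) :
    (0.0112 : ℝ) < accuracyThreshold (xPhenomFailureFamily (fun L => toricCode (L + 1)) T DX) ∧
      accuracyThreshold (xPhenomFailureFamily (fun L => toricCode (L + 1)) T DX) ≤ 1 / 4 :=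
  ⟨toric_x_phenom_accuracyThreshold_gt_0112 hT DX hDX,
    toric_x_phenom_threshold_le_quarter hT1 DX (isThresholdLowerBound_accuracyThreshold _)⟩

/-- **Exponential decay at every `0 ≤ p ≤ .0112`** of the `X`-sector phenomenological failure probability —
UNCONDITIONAL, kernel. [cite: DennisEtAl2002, §5.3 eq. (fail_iso)] -/
theorem toric_x_phenom_decaysExponentially_0112 {T : ℕ → ℕ} (hT : IsPolyBounded T)
    (DX : ∀ L, CSSPhenom.STDecoder (Vertex (L + 1)) (Edge (L + 1)) (T L))
    (hDX : ∀ L, (DX L).IsMinWeight (CSSPhenom.stSyn (toricCode (L + 1)).HZ (T L))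
      (CSSPhenom.stCycles (toricCode (L + 1)).HZ (T L)) hammingNorm)
    {p : ℝ} (hp₀ : 0 ≤ p) (hpp : p ≤ 0.0112) :
    DecaysExponentially (xPhenomFailureFamily (fun L => toricCode (L + 1)) T DX) p := by
  rw [xPhenomFailureFamily_toricCode]
  exact phenom_decaysExponentially_0112 hT (fun L => toric_isMinWeight_stDual (L + 1) (T L) (hDX L)) hp₀ hpp

/-! ### Two rates `p ≠ q` -/

/-- **Two-rate `X`-sector phenomenological threshold from `μ(ℤ³) ≤ 4.7476`**: `max(p, q) < p₀(4.7476)` suffices, every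
poly-bounded schedule, every minimum-weight space-time decoder family of the plaquette record — UNCONDITIONAL, kernel.
[cite: DennisEtAl2002, §5.3 eqs. (threshold_iso), (threshold_iso_num)] -/
theorem toric_x_phenom_aniso_belowThreshold_kernelZ3SymmK12 {T : ℕ → ℕ} (hT : IsPolyBounded T)
    (DX : ∀ L, CSSPhenom.STDecoder (Vertex (L + 1)) (Edge (L + 1)) (T L))
    (hDX : ∀ L, (DX L).IsMinWeight (CSSPhenom.stSyn (toricCode (L + 1)).HZ (T L))
      (CSSPhenom.stCycles (toricCode (L + 1)).HZ (T L)) hammingNorm)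
    {p q : ℝ} (hp0 : 0 ≤ p) (hq0 : 0 ≤ q) (hpq : max p q < thresholdValue 4.7476) :
    Tendsto (fun L => CSSPhenom.phenomFailureProb (toricCode (L + 1)).HZ (T L)
      ((toricCode (L + 1)).rowSpX : Set (Chain (L + 1))) (DX L) p q) atTop (𝓝 0) := by
  simp only [toric_xPhenomFailureProb_eq_dual]
  exact phenom_aniso_belowThreshold_kernelZ3SymmK12 hT
    (fun L => toric_isMinWeight_stDual (L + 1) (T L) (hDX L)) hp0 hq0 hpq

/-- **Decimal form: `0 ≤ p ≤ .0112` and `0 ≤ q ≤ .0112` ⇒ `Prob_fail^X(p, q) → 0`** — UNCONDITIONAL, kernel.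
[cite: DennisEtAl2002, §5.3 eq. (threshold_iso_num)] -/
theorem toric_x_phenom_aniso_belowThreshold_0112 {T : ℕ → ℕ} (hT : IsPolyBounded T)
    (DX : ∀ L, CSSPhenom.STDecoder (Vertex (L + 1)) (Edge (L + 1)) (T L))
    (hDX : ∀ L, (DX L).IsMinWeight (CSSPhenom.stSyn (toricCode (L + 1)).HZ (T L))
      (CSSPhenom.stCycles (toricCode (L + 1)).HZ (T L)) hammingNorm)
    {p q : ℝ} (hp0 : 0 ≤ p) (hq0 : 0 ≤ q) (hp : p ≤ 0.0112) (hq : q ≤ 0.0112) :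
    Tendsto (fun L => CSSPhenom.phenomFailureProb (toricCode (L + 1)).HZ (T L)
      ((toricCode (L + 1)).rowSpX : Set (Chain (L + 1))) (DX L) p q) atTop (𝓝 0) :=
  toric_x_phenom_aniso_belowThreshold_kernelZ3SymmK12 hT DX hDX hp0 hq0
    (lt_of_le_of_lt (max_le hp hq) thresholdValue_47476_bounds.1)

/-- **`X`-sector threshold box `p₀(4.7476)`** in the `IsThresholdBoxLowerBound` vocabulary — UNCONDITIONAL, kernel.
[cite: DennisEtAl2002, §5.3 eqs. (threshold_iso), (threshold_iso_num)] -/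
theorem toric_x_phenom_isThresholdBoxLowerBound_kernelZ3SymmK12 {T : ℕ → ℕ} (hT : IsPolyBounded T)
    (DX : ∀ L, CSSPhenom.STDecoder (Vertex (L + 1)) (Edge (L + 1)) (T L))
    (hDX : ∀ L, (DX L).IsMinWeight (CSSPhenom.stSyn (toricCode (L + 1)).HZ (T L))
      (CSSPhenom.stCycles (toricCode (L + 1)).HZ (T L)) hammingNorm) :
    IsThresholdBoxLowerBound (xPhenomFailureFamily₂ (fun L => toricCode (L + 1)) T DX) (thresholdValue 4.7476) := by
  rw [xPhenomFailureFamily₂_toricCode]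
  exact phenom_isThresholdBoxLowerBound_kernelZ3SymmK12 hT fun L => toric_isMinWeight_stDual (L + 1) (T L) (hDX L)

/-- **The decimal `X`-sector box `.0112`** — UNCONDITIONAL, kernel. [cite: DennisEtAl2002, §5.3 eq. (threshold_iso_num)] -/
theorem toric_x_phenom_isThresholdBoxLowerBound_0112 {T : ℕ → ℕ} (hT : IsPolyBounded T)
    (DX : ∀ L, CSSPhenom.STDecoder (Vertex (L + 1)) (Edge (L + 1)) (T L))
    (hDX : ∀ L, (DX L).IsMinWeight (CSSPhenom.stSyn (toricCode (L + 1)).HZ (T L))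
      (CSSPhenom.stCycles (toricCode (L + 1)).HZ (T L)) hammingNorm) :
    IsThresholdBoxLowerBound (xPhenomFailureFamily₂ (fun L => toricCode (L + 1)) T DX) 0.0112 :=
  (toric_x_phenom_isThresholdBoxLowerBound_kernelZ3SymmK12 hT DX hDX).mono thresholdValue_47476_bounds.1.le

/-! ### Both sectors -/

/-- **Both sectors below threshold at `p, q ≤ .0112`**: with BOTH records (star and plaquette) decoded by minimum-weight
space-time decoders, the `Z`-sector AND the `X`-sector failure probabilities of the `(L+1) × (L+1)` toric codes tend to
`0` for every `0 ≤ p, q ≤ .0112` and every polynomially bounded schedule — UNCONDITIONAL, kernel.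
[cite: DennisEtAl2002, §4.2 (both check types measured each round) and §5.3 eq. (threshold_iso_num)] -/
theorem toric_bothSectors_phenom_belowThreshold_0112 {T : ℕ → ℕ} (hT : IsPolyBounded T)
    (DZ : (L : ℕ) → STDecoder (L + 1) (T L))
    (hDZ : ∀ L, (DZ L).IsMinWeight (stSyn (L + 1) (T L)) (stCycles (L + 1) (T L)) hammingNorm)
    (DX : ∀ L, CSSPhenom.STDecoder (Vertex (L + 1)) (Edge (L + 1)) (T L))
    (hDX : ∀ L, (DX L).IsMinWeight (CSSPhenom.stSyn (toricCode (L + 1)).HZ (T L))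
      (CSSPhenom.stCycles (toricCode (L + 1)).HZ (T L)) hammingNorm)
    {p q : ℝ} (hp0 : 0 ≤ p) (hq0 : 0 ≤ q) (hp : p ≤ 0.0112) (hq : q ≤ 0.0112) :
    Tendsto (fun L => phenomFailureProb (L + 1) (T L) (DZ L) p q) atTop (𝓝 0) ∧
      Tendsto (fun L => CSSPhenom.phenomFailureProb (toricCode (L + 1)).HZ (T L)
        ((toricCode (L + 1)).rowSpX : Set (Chain (L + 1))) (DX L) p q) atTop (𝓝 0) :=
  ⟨phenom_aniso_belowThreshold_0112 hT hDZ hp0 hq0 hp hq,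
    toric_x_phenom_aniso_belowThreshold_0112 hT DX hDX hp0 hq0 hp hq⟩

/-! ### Finite size (appended, qec-type-09 gen 5) -/

/-- **Finite-size two-rate bound for the `X` sector at DKLP's elementary cubic count** (`cₙ(ℤ³) ≤ (6/5)·5ⁿ`): for `L ≥ 3`, a
minimum-weight space-time decoder of the plaquette record, `0 ≤ p, q ≤ ρ ≤ 1/2` and `s := √(ρ(1-ρ))` with `10s < 1`,
`Prob_fail^X(p, q) ≤ 2L²(T+1)·(6/5)·(10s)^L/(5(1-10s))` — the `Z`-sector bound `phenom_aniso_failureProb_le_five` transported by the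
space-time duality. UNCONDITIONAL, kernel. [cite: DennisEtAl2002, §5.3 eqs. (saw_d), (fail_iso)] -/
theorem toric_x_phenom_failureProb_le_five (L T : ℕ) [NeZero L] (hL : 3 ≤ L)
    {DX : CSSPhenom.STDecoder (Vertex L) (Edge L) T}
    (hDX : DX.IsMinWeight (CSSPhenom.stSyn (toricCode L).HZ T) (CSSPhenom.stCycles (toricCode L).HZ T) hammingNorm)
    {p q ρ : ℝ} (hp0 : 0 ≤ p) (hq0 : 0 ≤ q) (hpρ : p ≤ ρ) (hqρ : q ≤ ρ) (hρ : ρ ≤ 1 / 2)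
    (hs : 10 * Real.sqrt (ρ * (1 - ρ)) < 1) :
    CSSPhenom.phenomFailureProb (toricCode L).HZ T ((toricCode L).rowSpX : Set (Chain L)) DX p q ≤
      2 * (L : ℝ) ^ 2 * ((T : ℝ) + 1) * (6 / 5) * (2 * 5 * Real.sqrt (ρ * (1 - ρ))) ^ L /
        (5 * (1 - 2 * 5 * Real.sqrt (ρ * (1 - ρ)))) := by
  rw [toric_xPhenomFailureProb_eq_dual]
  exact phenom_aniso_failureProb_le_five L T hL (toric_isMinWeight_stDual L T hDX) hp0 hq0 hpρ hqρ hρ hs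

end Summit.Ventures.QEC.Thresholds

end
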